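import Summits.QuantumFields.YangMills.Theorems.ConvexGribovBodyCovarianceBoundMomentReduction
import Summits.QuantumFields.YangMills.Theorems.ConvexGribovBodyCovarianceBoundStubSupLeCov
import HarnessLib

/-!
# The converse of the moment reduction: `CovarianceBound` implies both of its halves
# (crux stmt-QuantumFields-8780, line `Sketch`, skeleton v7)

Route `QuantumFields/YangMills/ConvexGribovBody`, crux
`Summit.QuantumFields.YangMills.Theses.ConvexGribovBody.CovarianceBound`.

Companion of `…CovarianceBoundMomentReduction` (defs `LieModeBound`, `PerpModeBound` and
`covarianceBound_of_modeBounds : LieModeBound → PerpModeBound → CovarianceBound`). Here the CONVERSE: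
`modeBounds_of_covarianceBound : CovarianceBound → LieModeBound ∧ PerpModeBound` (with the same `β₀`, `D`, `S₀`),
from the pointwise domination `sup_h ‖P_𝔤 Ĉ_j(p)‖²_F, sup_h ‖P_⊥ Ĉ_j(p)‖²_F ≤ L³ · sup_h cov(U,h,p)` of the wave-1 stub
`stub_supLeCov`, integrated against Wilson's probability measure (all sups bounded and Borel by `stub_supMeasurable` /
`stub_projSplit`). Consequently `covarianceBound_iff_modeBounds : CovarianceBound ↔ LieModeBound ∧ PerpModeBound`:
the line `Sketch` splits the crux into two statements of the SAME strength (its 𝔤- and 𝔤^⊥-halves); neither half is a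
weakening, which is the precise sense in which the two open stubs of skeleton v7 are crux-sized. (The companion
`…WindowToMoments` adds `ZeroFreeWindowLie → LieModeBound` and `ZeroFreeWindowPerp → PerpModeBound`: each Lee–Yang window of
v6 is a sufficient mechanism for the corresponding half on its own.)
-/

set_option autoImplicit false

noncomputable section

namespace Summit.QuantumFields.YangMills.Cruxes.CovarianceBound.SupportWindow

open scoped BigOperators Topology Classical MeasureTheory ProbabilityTheory Matrix ComplexConjugate
open Filter Set Function TopologicalSpace MeasureTheory
open Literature.MathematicalPhysics.QuantumFieldTheory

/-- One configuration space at a time: if `∫ sup cov ≤ D` then `∫ sup‖P_𝔤 Ĉ_j‖² ≤ D L³` and `∫ sup‖P_⊥ Ĉ_j‖² ≤ D L³`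
(pointwise domination `stub_supLeCov`, monotonicity of the integral for the bounded Borel sups). -/
theorem integral_supLie_supPerp_le {G : Type} [Group G] [TopologicalSpace G] [IsTopologicalGroup G]
    [CompactSpace G] [MeasurableSpace G] [BorelSpace G] (r : LatticeRep G) (β : ℝ) (S : ℕ)
    (p : Fin 3 → ZMod (2 * S + 1)) (j : Fin 3) {D : ℝ}
    (hcov : ∫ U, supCov r S p U ∂(wilson4 r β S) ≤ D) :
    (∫ U, supLieCosSq r S p j U ∂(wilson4 r β S) ≤ D * (2 * S + 1 : ℝ) ^ 3) ∧
      (∫ U, supPerpCosSq r S p j U ∂(wilson4 r β S) ≤ D * (2 * S + 1 : ℝ) ^ 3) := by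
  have hM := stub_supMeasurable G r S p j
  have hP := stub_projSplit G r S p j
  have hle := stub_supLeCov G r S p j
  have hL3 : (0 : ℝ) ≤ (2 * S + 1 : ℝ) ^ 3 := by positivity
  have hmC : Measurable (supCov r S p) := hM.2.2.1
  have hbC : ∀ U, 0 ≤ supCov r S p U ∧ supCov r S p U ≤ 3 * r.N * (2 * S + 1 : ℝ) ^ 3 :=
    fun U => (hM.2.2.2.2.2 U).1
  have hcosb : ∀ (U : GaugeConfig 4 (2 * S + 1) G) (h : Site 4 (2 * S + 1) → G),
      IsCoulMin r S U h → froSq (cosMode r S p j U h) ≤ r.N * (2 * S + 1 : ℝ) ^ 6 :=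
    fun U h _ => (hM.2.1 U h).2.1
  have hbL : ∀ U, 0 ≤ supLieCosSq r S p j U ∧ supLieCosSq r S p j U ≤ r.N * (2 * S + 1 : ℝ) ^ 6 :=
    fun U => ⟨(hP.2.2.2 U (hcosb U)).1, (hP.2.2.2 U (hcosb U)).2.1⟩
  have hbP : ∀ U, 0 ≤ supPerpCosSq r S p j U ∧ supPerpCosSq r S p j U ≤ r.N * (2 * S + 1 : ℝ) ^ 6 :=
    fun U => ⟨(hP.2.2.2 U (hcosb U)).2.2.1, (hP.2.2.2 U (hcosb U)).2.2.2.1⟩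
  have hintC : Integrable (supCov r S p) (wilson4 r β S) :=
    Integrable.of_mem_Icc 0 (3 * r.N * (2 * S + 1 : ℝ) ^ 3) hmC.aemeasurable
      (ae_of_all _ fun U => ⟨(hbC U).1, (hbC U).2⟩)
  have hintL : Integrable (supLieCosSq r S p j) (wilson4 r β S) :=
    Integrable.of_mem_Icc 0 (r.N * (2 * S + 1 : ℝ) ^ 6) (hP.2.1).aemeasurable
      (ae_of_all _ fun U => ⟨(hbL U).1, (hbL U).2⟩)
  have hintP : Integrable (supPerpCosSq r S p j) (wilson4 r β S) :=
    Integrable.of_mem_Icc 0 (r.N * (2 * S + 1 : ℝ) ^ 6) (hP.2.2.1).aemeasurable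
      (ae_of_all _ fun U => ⟨(hbP U).1, (hbP U).2⟩)
  have hscaled : ∫ U, (2 * S + 1 : ℝ) ^ 3 * supCov r S p U ∂(wilson4 r β S) ≤ D * (2 * S + 1 : ℝ) ^ 3 := by
    rw [integral_const_mul]
    nlinarith [hcov, hL3]
  constructor
  · calc ∫ U, supLieCosSq r S p j U ∂(wilson4 r β S)
        ≤ ∫ U, (2 * S + 1 : ℝ) ^ 3 * supCov r S p U ∂(wilson4 r β S) :=
          integral_mono hintL (hintC.const_mul _) fun U => (hle U).2.1
      _ ≤ D * (2 * S + 1 : ℝ) ^ 3 := hscaled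
  · calc ∫ U, supPerpCosSq r S p j U ∂(wilson4 r β S)
        ≤ ∫ U, (2 * S + 1 : ℝ) ^ 3 * supCov r S p U ∂(wilson4 r β S) :=
          integral_mono hintP (hintC.const_mul _) fun U => (hle U).2.2
      _ ≤ D * (2 * S + 1 : ℝ) ^ 3 := hscaled

/-- **Converse of the moment reduction** (registered glue `modeBounds_of_covarianceBound`): the crux implies both of
its halves, with the same `β₀`, `D`, `S₀`. -/
theorem modeBounds_of_covarianceBound :
    Summit.QuantumFields.YangMills.Theses.ConvexGribovBody.CovarianceBound → LieModeBound ∧ PerpModeBound := by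
  intro hcb
  rw [covarianceBound_iff] at hcb
  constructor
  · intro G _ _ _ _ _ _ hG r
    obtain ⟨β₀, hβ₀⟩ := hcb G hG r
    refine ⟨β₀, fun β hβ => ?_⟩
    obtain ⟨D, hD, S₀, hS₀⟩ := hβ₀ β hβ
    exact ⟨D, hD, S₀, fun S hS p j => (integral_supLie_supPerp_le r β S p j (hS₀ S hS p)).1⟩
  · intro G _ _ _ _ _ _ hG r
    obtain ⟨β₀, hβ₀⟩ := hcb G hG r
    refine ⟨β₀, fun β hβ => ?_⟩
    obtain ⟨D, hD, S₀, hS₀⟩ := hβ₀ β hβ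
    exact ⟨D, hD, S₀, fun S hS p j => (integral_supLie_supPerp_le r β S p j (hS₀ S hS p)).2⟩

/-- **The crux is exactly the conjunction of its two halves**: `CovarianceBound ↔ LieModeBound ∧ PerpModeBound`
(forward `modeBounds_of_covarianceBound`, backward `covarianceBound_of_modeBounds`). -/
theorem covarianceBound_iff_modeBounds :
    Summit.QuantumFields.YangMills.Theses.ConvexGribovBody.CovarianceBound ↔ LieModeBound ∧ PerpModeBound :=
  ⟨modeBounds_of_covarianceBound, fun h => covarianceBound_of_modeBounds h.1 h.2⟩

end Summit.QuantumFields.YangMills.Cruxes.CovarianceBound.SupportWindow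

end
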